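import Summits.ResolutionOfSingularities.ResolutionOfSingularities.Theorems.EquisingularLiftEquisingularLiftNatThreeLinesSections
import HarnessLib

/-!
# [OURS · L1 W4.5(b) · EL♮(3) · nose residue, (c) file 5b] THE THREE LINES THROUGH THE CHART MODELS: bookkeeping for the ×3 union certificate

Crux chain w45b, child EL♮(3) = stmt-ResolutionOfSingularities-20148; WIDTH seat res-L1-w45b-nose-w3 g3 (D-0157 DOOR 1), brick (c) = the ×3 UNION
certificate of res-L1-w45b-nose-w2's «Steiner ∈ ν2» assembly (027's recipe of record, STATUS 2026-08-28T19:33Z). This file isolates the generic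
chart/model bookkeeping used by the assembly ✓ `ThreeLines.dirStepUnobs_threeLines` (file 5c): every statement takes the chart isomorphism
`θ = ΓSpecIso ∘ c.appIso ⊤` as a NAMED isomorphism with its defining equation, so that the assembly can keep `θ` opaque (its body must never be
unfolded by unification). `--supports stmt-ResolutionOfSingularities-20148 --as helper`. OURS; NOT a statement of any manuscript; AI-written, weaker
than expert review. No `sorry`; standard axioms; DEF-FREE. EL♮(3) is NOT proved by this file; resolution of singularities in positive characteristic
is NOT proved here; counted 0.

* `res_res`, `pt_mem` — trivial bookkeeping.
* ★ `ideal_basicOpen_eq_map` — `𝓘⟨Z⟩(D(ℓ)) = (res ∘ θ⁻¹ ∘ Φ)(𝔞)·Γ(D(ℓ))` when `c⁻¹Z = V(Φ𝔞)`, `Φ𝔞` radical (the socket's `hI` on a basic open).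
* ★ `powers_map_eq`, `ringEquivOfRingEquiv_symm_algebraMap`, `exists_modelLocalization`, `isQuasiRegular_pair_of_model` — `Γ(P, D(θ⁻¹Φℓ)) ≅ M[1/ℓ]`
  and the transport of quasi-regularity (the socket's `hqr`).
* `apply_mem_basicOpen_symm` — a chart point on `V(I)` lies in `D(θ⁻¹r)` when `r` avoids the primes over `I` (the socket's `hcov`).
* ★ `preimage_vertexChart_threeLines`, ★ `preimage_lift_threeLines`, ★ `threeLines_subset_union` — the three lines on the two charts of a blowing up
  of the vertex of `ℙ³`, through the models of ✓ `exists_modelEquiv_chart/away`.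

References (index only): R. Hartshorne (1977), II Example 3.2.6, II §7 [cite: Hartshorne1977]; The Stacks Project, Tags 0804, 01ED [cite: StacksProject];
A. J. de Jong (1996), proof of Lemma 4.11 [cite: DeJong1996].
-/

set_option linter.dupNamespace false -- mandated namespace `Summit.<Summit>.<Problem>` of this single-conjunct summit

noncomputable section

-- `Proj`/`ProjectiveSpectrum` carrier coercions under `instances` transparency (as in the chain's other chart files).
set_option backward.isDefEq.respectTransparency false

open CategoryTheory AlgebraicGeometry TopologicalSpace HomogeneousLocalization Topology Opposite MvPolynomial
open Literature.AlgebraicGeometry.Resolution Literature.AlgebraicGeometry.Resolution.DeJong1996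
open Literature.AlgebraicGeometry.Resolution.PointBlowup (Chart Base frac exc)
open Literature.AlgebraicGeometry.Motives.Segre (grading X_mem chartι toSpec)
open Literature.AlgebraicGeometry.Motives.RatFn
open AlgebraicGeometry.Scheme.IdealSheafData

attribute [local instance] MvPolynomial.gradedAlgebra Literature.AlgebraicGeometry.Motives.ProjBaseChange.algebraBase
  Literature.AlgebraicGeometry.Motives.ProjBaseChange.isScalarTower_localization

namespace Summit.ResolutionOfSingularities.ResolutionOfSingularities.Cruxes.EquisingularLiftNat.Sections

variable {k : Type} [Field k]

namespace ThreeLines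

/-! ## Bookkeeping -/

/-- Restricting twice is restricting once (pointwise form). [folklore] -/
theorem res_res {P : Scheme.{0}} {U V W : P.Opens} (h₁ : V ≤ U) (h₂ : W ≤ V) (s : Γ(P, U)) :
    P.presheaf.map (homOfLE h₂).op (P.presheaf.map (homOfLE h₁).op s) = P.presheaf.map (homOfLE (h₂.trans h₁)).op s := by
  rw [← CommRingCat.comp_apply, ← Functor.map_comp]
  rfl

/-- **The reduced ideal of `Z` on a basic open `D(ℓ)` of a chart `c : Spec R ⟶ P`, through a model `Φ : M ≅ R`**: if `c⁻¹Z = V(Φ𝔞)` with `Φ𝔞`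
radical, then `𝓘⟨Z⟩(D(ℓ)) = ψ(𝔞)·Γ(D(ℓ))` for `ψ = res ∘ θ⁻¹ ∘ Φ : M → Γ(P, D(ℓ))` (`θ = ΓSpecIso ∘ c.appIso ⊤`, taken as a named
isomorphism `θ` with its defining equation so that users may keep `θ` opaque).
[cite: Hartshorne1977, II Example 3.2.6] (OURS bookkeeping, on ✓ `vanishingIdeal_ideal_image_eq_comap`) -/
theorem ideal_basicOpen_eq_map {P : Scheme.{0}} {R : CommRingCat.{0}} (c : Spec R ⟶ P) [IsOpenImmersion c]
    (θ : Γ(P, c ''ᵁ ⊤) ≃+* R) (hθ : θ = (c.appIso ⊤ ≪≫ Scheme.ΓSpecIso R).commRingCatIsoToRingEquiv) (Z : Closeds P)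
    {M : Type} [CommRing M] (Φ : M ≃+* R) (𝔞 : Ideal M) (hrad : (𝔞.map Φ).IsRadical)
    (hpre : c ⁻¹' (Z : Set P) = PrimeSpectrum.zeroLocus ((𝔞.map Φ : Ideal R) : Set R)) (ℓ : Γ(P, c ''ᵁ ⊤)) :
    (vanishingIdeal Z).ideal ⟨P.basicOpen ℓ, (isAffineOpen_image_top c).basicOpen ℓ⟩ =
      𝔞.map (((P.presheaf.map (homOfLE (P.basicOpen_le ℓ)).op).hom.comp (θ.symm : R →+* Γ(P, c ''ᵁ ⊤))).comp (Φ : M →+* R)) := by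
  subst hθ
  rw [← (vanishingIdeal Z).map_ideal (show (⟨P.basicOpen ℓ, (isAffineOpen_image_top c).basicOpen ℓ⟩ : P.affineOpens) ≤
      ⟨c ''ᵁ ⊤, isAffineOpen_image_top c⟩ from P.basicOpen_le ℓ),
    vanishingIdeal_ideal_image_eq_comap c Z (𝔞.map Φ) hrad hpre, ← Ideal.map_map, ← Ideal.map_map, Ideal.map_coe, Ideal.comap_coe,
    ← Ideal.map_symm]
  rfl

/-- `(θ ∘ Φ⁻¹)`… bookkeeping: the powers of `θ⁻¹Φℓ` map to the powers of `ℓ` under `Φ⁻¹ ∘ θ`. [folklore] -/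
theorem powers_map_eq {P : Scheme.{0}} {U : P.Opens} {R M : Type} [CommRing R] [CommRing M] (θ : Γ(P, U) ≃+* R) (Φ : M ≃+* R)
    (ℓ : M) : (Submonoid.powers (θ.symm (Φ ℓ))).map (θ.trans Φ.symm).toMonoidHom = Submonoid.powers ℓ := by
  rw [Submonoid.map_powers]
  congr 1
  change Φ.symm (θ (θ.symm (Φ ℓ))) = ℓ
  rw [RingEquiv.apply_symm_apply, RingEquiv.symm_apply_apply]

/-- **The model localisation `M[1/ℓ] ≅ Γ(P, D(θ⁻¹Φℓ))`** (✓ `IsLocalization.ringEquivOfRingEquiv` along `Φ⁻¹ ∘ θ : Γ(P, U) ≅ M`, `U` affine)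
sends `r/1` to the restriction of `θ⁻¹Φr`. [folklore] -/
theorem ringEquivOfRingEquiv_symm_algebraMap {P : Scheme.{0}} {U : P.Opens} (hU : IsAffineOpen U) {R M L : Type} [CommRing R]
    [CommRing M] [CommRing L] (θ : Γ(P, U) ≃+* R) (Φ : M ≃+* R) (ℓ : M) [Algebra M L] [IsLocalization.Away ℓ L] (r : M) :
    haveI := hU.isLocalization_basicOpen (θ.symm (Φ ℓ))
    (IsLocalization.ringEquivOfRingEquiv (M := Submonoid.powers (θ.symm (Φ ℓ))) (T := Submonoid.powers ℓ)
        Γ(P, P.basicOpen (θ.symm (Φ ℓ))) L (θ.trans Φ.symm) (powers_map_eq θ Φ ℓ)).symm (algebraMap M L r) =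
      P.presheaf.map (homOfLE (P.basicOpen_le (θ.symm (Φ ℓ)))).op (θ.symm (Φ r)) := by
  haveI := hU.isLocalization_basicOpen (θ.symm (Φ ℓ))
  rw [RingEquiv.symm_apply_eq]
  have e := IsLocalization.ringEquivOfRingEquiv_eq (M := Submonoid.powers (θ.symm (Φ ℓ))) (T := Submonoid.powers ℓ)
    (S := Γ(P, P.basicOpen (θ.symm (Φ ℓ)))) (Q := L) (powers_map_eq θ Φ ℓ) (θ.symm (Φ r))
  rw [RingEquiv.coe_trans, Function.comp_apply, RingEquiv.apply_symm_apply, RingEquiv.symm_apply_apply] at e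
  exact e.symm

/-- **The model localisation, packaged**: an isomorphism `e : Γ(P, D(θ⁻¹Φℓ)) ≅ M[1/ℓ]` with `e⁻¹(r/1) = (θ⁻¹Φr)|` (kept opaque by users).
[folklore] -/
theorem exists_modelLocalization {P : Scheme.{0}} {U : P.Opens} (hU : IsAffineOpen U) {R M L : Type} [CommRing R] [CommRing M]
    [CommRing L] (θ : Γ(P, U) ≃+* R) (Φ : M ≃+* R) (ℓ : M) [Algebra M L] [IsLocalization.Away ℓ L] :
    ∃ e : Γ(P, P.basicOpen (θ.symm (Φ ℓ))) ≃+* L,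
      ∀ r : M, e.symm (algebraMap M L r) = P.presheaf.map (homOfLE (P.basicOpen_le (θ.symm (Φ ℓ)))).op (θ.symm (Φ r)) :=
  ⟨_, ringEquivOfRingEquiv_symm_algebraMap hU θ Φ ℓ⟩

/-- **Quasi-regularity through a model localisation**: for an affine open `U`, `θ : Γ(P, U) ≅ R`, a model `Φ : M ≅ R` and `ℓ, f, g ∈ M` with
`(f, g)` quasi-regular in `M[1/ℓ]`, the restrictions of `θ⁻¹Φf, θ⁻¹Φg` to `D(θ⁻¹Φℓ)` are quasi-regular (`Γ(P, D(θ⁻¹Φℓ)) ≅ M[1/ℓ]`,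
✓ `IsQuasiRegular.map_ringEquiv`). [folklore] -/
theorem isQuasiRegular_pair_of_model {P : Scheme.{0}} {U : P.Opens} (hU : IsAffineOpen U) {R M L : Type} [CommRing R] [CommRing M]
    [CommRing L] (θ : Γ(P, U) ≃+* R) (Φ : M ≃+* R) (ℓ f g : M) [Algebra M L] [IsLocalization.Away ℓ L]
    (hqr : IsQuasiRegular ![algebraMap M L f, algebraMap M L g]) :
    IsQuasiRegular ![P.presheaf.map (homOfLE (P.basicOpen_le (θ.symm (Φ ℓ)))).op (θ.symm (Φ f)),
      P.presheaf.map (homOfLE (P.basicOpen_le (θ.symm (Φ ℓ)))).op (θ.symm (Φ g))] := by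
  haveI := hU.isLocalization_basicOpen (θ.symm (Φ ℓ))
  have hfun : (![P.presheaf.map (homOfLE (P.basicOpen_le (θ.symm (Φ ℓ)))).op (θ.symm (Φ f)),
      P.presheaf.map (homOfLE (P.basicOpen_le (θ.symm (Φ ℓ)))).op (θ.symm (Φ g))] : Fin 2 → Γ(P, P.basicOpen (θ.symm (Φ ℓ)))) =
      (IsLocalization.ringEquivOfRingEquiv (M := Submonoid.powers (θ.symm (Φ ℓ))) (T := Submonoid.powers ℓ)
        Γ(P, P.basicOpen (θ.symm (Φ ℓ))) L (θ.trans Φ.symm) (powers_map_eq θ Φ ℓ)).symm ∘ ![algebraMap M L f, algebraMap M L g] := by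
    funext m
    fin_cases m
    · exact (ringEquivOfRingEquiv_symm_algebraMap hU θ Φ ℓ f).symm
    · exact (ringEquivOfRingEquiv_symm_algebraMap hU θ Φ ℓ g).symm
  rw [hfun]
  exact hqr.map_ringEquiv _

/-- **A chart point lies in `D(θ⁻¹ r)` when `r` avoids every prime over `I` and the point lies on `V(I)`.** [folklore] -/
theorem apply_mem_basicOpen_symm {P : Scheme.{0}} {R : CommRingCat.{0}} (c : Spec R ⟶ P) [IsOpenImmersion c]
    (θ : Γ(P, c ''ᵁ ⊤) ≃+* R) (hθ : θ = (c.appIso ⊤ ≪≫ Scheme.ΓSpecIso R).commRingCatIsoToRingEquiv) (I : Ideal R) (r : R)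
    (hI : ∀ 𝔮 : PrimeSpectrum R, I ≤ 𝔮.asIdeal → r ∉ 𝔮.asIdeal) (𝔭 : Spec R) (h𝔭 : 𝔭 ∈ PrimeSpectrum.zeroLocus ((I : Ideal R) : Set R)) :
    c 𝔭 ∈ P.basicOpen (θ.symm r) := by
  subst hθ
  have h := hI 𝔭 (by rwa [PrimeSpectrum.mem_zeroLocus, SetLike.coe_subset_coe] at h𝔭)
  exact (apply_mem_basicOpen_iff c r 𝔭).mpr h

/-- The index set of the three lines: `q ∈ {(0,0), (1,0), (0,1)}`. [folklore] -/
theorem pt_mem (i : Fin (2 + 1)) : (![![0, 0], ![1, 0], ![0, 1]] : Fin (2 + 1) → Fin 2 → k) i = ![0, 0] ∨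
    (![![0, 0], ![1, 0], ![0, 1]] : Fin (2 + 1) → Fin 2 → k) i = ![1, 0] ∨ (![![0, 0], ![1, 0], ![0, 1]] : Fin (2 + 1) → Fin 2 → k) i = ![0, 1] := by
  fin_cases i
  · exact Or.inl rfl
  · exact Or.inr (Or.inl rfl)
  · exact Or.inr (Or.inr rfl)

/-! ## The three lines on the two charts, through the models -/

section Charts

variable {P : Scheme.{0}} (b : P ⟶ Proj (grading (Fin (2 + 1 + 1)) k)) (hb : IsBlowup b (vertexIdealSheaf 2 k))

include hb in
/-- ★ **On the vertex chart, `c₀⁻¹(⋃ᵢ Lᵢ′) = V(Φ_A(𝔮₀₀ ∩ 𝔮₁₀ ∩ 𝔮₀₁))`** for any model identification `Φ_A : k[u][T] ≅ C₀` with the values of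
✓ `exists_modelEquiv_chart` (✓ `preimage_vertexChart_line` ×3, ✓ `map_lineIdeal`, ✓ `preimage_iUnion_eq_zeroLocus`). [cite: Hartshorne1977, II §7] (OURS) -/
theorem preimage_vertexChart_threeLines (Φ : MvPolynomial Unit (MvPolynomial (Fin 2) k) ≃+* Chart 2 k 0)
    (hΦ0 : Φ (C (X 0)) = frac 2 k 0 1) (hΦ1 : Φ (C (X 1)) = frac 2 k 0 2) (hΦc : ∀ a : k, Φ (C (C a)) = algebraMap k (Chart 2 k 0) a) :
    (vertexChart hb 0) ⁻¹' (⋃ i : Fin (2 + 1), closure (b ⁻¹' ({y : Proj (grading (Fin (2 + 1 + 1)) k) |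
        (X 1 - C ((![![0, 0], ![1, 0], ![0, 1]] : Fin (2 + 1) → Fin 2 → k) i 0) * X 0 : MvPolynomial (Fin (2 + 1 + 1)) k) ∈
            y.asHomogeneousIdeal ∧
        (X 2 - C ((![![0, 0], ![1, 0], ![0, 1]] : Fin (2 + 1) → Fin 2 → k) i 1) * X 0 : MvPolynomial (Fin (2 + 1 + 1)) k) ∈
            y.asHomogeneousIdeal} \ {vertex 2 k}))) =
      PrimeSpectrum.zeroLocus ((((RingHom.ker (eval ![0, 0] : MvPolynomial (Fin 2) k →+* k)).map
          (C : MvPolynomial (Fin 2) k →+* MvPolynomial Unit (MvPolynomial (Fin 2) k)) ⊓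
        (RingHom.ker (eval ![1, 0] : MvPolynomial (Fin 2) k →+* k)).map
          (C : MvPolynomial (Fin 2) k →+* MvPolynomial Unit (MvPolynomial (Fin 2) k)) ⊓
        (RingHom.ker (eval ![0, 1] : MvPolynomial (Fin 2) k →+* k)).map
          (C : MvPolynomial (Fin 2) k →+* MvPolynomial Unit (MvPolynomial (Fin 2) k))).map Φ : Ideal (Chart 2 k 0)) : Set (Chart 2 k 0)) := by
  have h := preimage_iUnion_eq_zeroLocus Φ (id : PrimeSpectrum (Chart 2 k 0) → PrimeSpectrum (Chart 2 k 0))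
    (Z := fun i => (vertexChart hb 0) ⁻¹' closure (b ⁻¹' ({y : Proj (grading (Fin (2 + 1 + 1)) k) |
          (X 1 - C ((![![0, 0], ![1, 0], ![0, 1]] : Fin (2 + 1) → Fin 2 → k) i 0) * X 0 : MvPolynomial (Fin (2 + 1 + 1)) k) ∈
              y.asHomogeneousIdeal ∧
          (X 2 - C ((![![0, 0], ![1, 0], ![0, 1]] : Fin (2 + 1) → Fin 2 → k) i 1) * X 0 : MvPolynomial (Fin (2 + 1 + 1)) k) ∈
              y.asHomogeneousIdeal} \ {vertex 2 k})))
    (fun i => by rw [preimage_vertexChart_line b hb, map_lineIdeal Φ hΦ0 hΦ1 hΦc])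
  simpa only [Set.preimage_id_eq, id_eq, ← Set.preimage_iUnion] using h

variable (cB : Spec (.of (Away (grading (Fin (2 + 1 + 1)) k) (MvPolynomial.X (Fin.castSucc (0 : Fin (2 + 1)))))) ⟶ P)
  (hcB : cB ≫ b = chartι k (Fin.castSucc (0 : Fin (2 + 1))))

include hcB in
/-- ★ **On the lifted chart `D₊(x₀)`, `c_B⁻¹(⋃ᵢ Lᵢ′) = V(Φ_B(𝔮₀₀ ∩ 𝔮₁₀ ∩ 𝔮₀₁))`** for any `Φ_B : k[u][T] ≅ (k[x]_{x₀})₀` with the values of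
✓ `exists_modelEquiv_away` (✓ `preimage_lift_line` ×3). [cite: Hartshorne1977, II §7] (OURS) -/
theorem preimage_lift_threeLines
    (Φ : MvPolynomial Unit (MvPolynomial (Fin 2) k) ≃+* Away (grading (Fin (2 + 1 + 1)) k) (X (Fin.castSucc (0 : Fin (2 + 1)))))
    (hΦ0 : Φ (C (X 0)) = Literature.AlgebraicGeometry.Motives.Segre.frac k (Fin.castSucc (0 : Fin (2 + 1))) (Fin.castSucc (1 : Fin (2 + 1))))
    (hΦ1 : Φ (C (X 1)) = Literature.AlgebraicGeometry.Motives.Segre.frac k (Fin.castSucc (0 : Fin (2 + 1))) (Fin.castSucc (2 : Fin (2 + 1))))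
    (hΦc : ∀ a : k, Φ (C (C a)) = algebraMap k _ a) :
    cB ⁻¹' (⋃ i : Fin (2 + 1), closure (b ⁻¹' ({y : Proj (grading (Fin (2 + 1 + 1)) k) |
        (X 1 - C ((![![0, 0], ![1, 0], ![0, 1]] : Fin (2 + 1) → Fin 2 → k) i 0) * X 0 : MvPolynomial (Fin (2 + 1 + 1)) k) ∈
            y.asHomogeneousIdeal ∧
        (X 2 - C ((![![0, 0], ![1, 0], ![0, 1]] : Fin (2 + 1) → Fin 2 → k) i 1) * X 0 : MvPolynomial (Fin (2 + 1 + 1)) k) ∈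
            y.asHomogeneousIdeal} \ {vertex 2 k}))) =
      PrimeSpectrum.zeroLocus ((((RingHom.ker (eval ![0, 0] : MvPolynomial (Fin 2) k →+* k)).map
          (C : MvPolynomial (Fin 2) k →+* MvPolynomial Unit (MvPolynomial (Fin 2) k)) ⊓
        (RingHom.ker (eval ![1, 0] : MvPolynomial (Fin 2) k →+* k)).map
          (C : MvPolynomial (Fin 2) k →+* MvPolynomial Unit (MvPolynomial (Fin 2) k)) ⊓
        (RingHom.ker (eval ![0, 1] : MvPolynomial (Fin 2) k →+* k)).map
          (C : MvPolynomial (Fin 2) k →+* MvPolynomial Unit (MvPolynomial (Fin 2) k))).map Φ : Ideal _) : Set _) := by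
  have h := preimage_iUnion_eq_zeroLocus Φ
    (id : PrimeSpectrum (Away (grading (Fin (2 + 1 + 1)) k) (X (Fin.castSucc (0 : Fin (2 + 1))))) → _)
    (Z := fun i => cB ⁻¹' closure (b ⁻¹' ({y : Proj (grading (Fin (2 + 1 + 1)) k) |
          (X 1 - C ((![![0, 0], ![1, 0], ![0, 1]] : Fin (2 + 1) → Fin 2 → k) i 0) * X 0 : MvPolynomial (Fin (2 + 1 + 1)) k) ∈
              y.asHomogeneousIdeal ∧
          (X 2 - C ((![![0, 0], ![1, 0], ![0, 1]] : Fin (2 + 1) → Fin 2 → k) i 1) * X 0 : MvPolynomial (Fin (2 + 1 + 1)) k) ∈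
              y.asHomogeneousIdeal} \ {vertex 2 k})))
    (fun i => by rw [preimage_lift_line b cB hcB, map_lineIdeal Φ hΦ0 hΦ1 hΦc])
  simpa only [Set.preimage_id_eq, id_eq, ← Set.preimage_iUnion] using h

include hb hcB in
/-- ★ **The three lines are covered by the two basic opens `D(ℓ_A) ⊆ c₀(Spec C₀)`, `D(ℓ_B) ⊆ b⁻¹D₊(x₀)`** (`ℓ_A = θ_A⁻¹Φ_A(ℓ)`,
`ℓ_B = θ_B⁻¹Φ_B(ℓ)`, `ℓ = u₂ + 1 + c(u₁ − 1)` with `c ∉ {1, 2}`): a point of `Lᵢ′` in either chart reads through the model as a prime over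
`𝔮_{qᵢ}`, where `ℓ ≡ ℓ(qᵢ) ≠ 0` (✓ `closure_line_subset_union`, ✓ `map_ell_notMem`). [folklore] (OURS) -/
theorem threeLines_subset_union (c : k) (hc1 : c ≠ 1) (hc2 : c ≠ 2)
    (θA : Γ(P, vertexChart hb 0 ''ᵁ ⊤) ≃+* (CommRingCat.of (Chart 2 k 0) : CommRingCat.{0}))
    (hθA : θA = ((vertexChart hb 0).appIso ⊤ ≪≫ Scheme.ΓSpecIso (.of (Chart 2 k 0))).commRingCatIsoToRingEquiv)
    (ΦA : MvPolynomial Unit (MvPolynomial (Fin 2) k) ≃+* Chart 2 k 0)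
    (hΦA0 : ΦA (C (X 0)) = frac 2 k 0 1) (hΦA1 : ΦA (C (X 1)) = frac 2 k 0 2) (hΦAc : ∀ a : k, ΦA (C (C a)) = algebraMap k (Chart 2 k 0) a)
    [IsOpenImmersion cB] (hcBim : cB ''ᵁ ⊤ = b ⁻¹ᵁ Proj.basicOpen (grading (Fin (2 + 1 + 1)) k) (X (Fin.castSucc (0 : Fin (2 + 1)))))
    (θB : Γ(P, cB ''ᵁ ⊤) ≃+* (CommRingCat.of (Away (grading (Fin (2 + 1 + 1)) k) (X (Fin.castSucc (0 : Fin (2 + 1))))) : CommRingCat.{0}))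
    (hθB : θB = (cB.appIso ⊤ ≪≫ Scheme.ΓSpecIso (.of _)).commRingCatIsoToRingEquiv)
    (ΦB : MvPolynomial Unit (MvPolynomial (Fin 2) k) ≃+* Away (grading (Fin (2 + 1 + 1)) k) (X (Fin.castSucc (0 : Fin (2 + 1)))))
    (hΦB0 : ΦB (C (X 0)) = Literature.AlgebraicGeometry.Motives.Segre.frac k (Fin.castSucc (0 : Fin (2 + 1))) (Fin.castSucc (1 : Fin (2 + 1))))
    (hΦB1 : ΦB (C (X 1)) = Literature.AlgebraicGeometry.Motives.Segre.frac k (Fin.castSucc (0 : Fin (2 + 1))) (Fin.castSucc (2 : Fin (2 + 1))))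
    (hΦBc : ∀ a : k, ΦB (C (C a)) = algebraMap k _ a) :
    (⋃ i : Fin (2 + 1), closure (b ⁻¹' ({y : Proj (grading (Fin (2 + 1 + 1)) k) |
        (X 1 - C ((![![0, 0], ![1, 0], ![0, 1]] : Fin (2 + 1) → Fin 2 → k) i 0) * X 0 : MvPolynomial (Fin (2 + 1 + 1)) k) ∈
            y.asHomogeneousIdeal ∧
        (X 2 - C ((![![0, 0], ![1, 0], ![0, 1]] : Fin (2 + 1) → Fin 2 → k) i 1) * X 0 : MvPolynomial (Fin (2 + 1 + 1)) k) ∈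
            y.asHomogeneousIdeal} \ {vertex 2 k}))) ⊆
      (P.basicOpen (θA.symm (ΦA (C (X 1 + 1 + C c * (X 0 - 1))))) : Set P) ∪
        (P.basicOpen (θB.symm (ΦB (C (X 1 + 1 + C c * (X 0 - 1))))) : Set P) := by
  intro z hz
  obtain ⟨i, hi⟩ := Set.mem_iUnion.mp hz
  rcases closure_line_subset_union b hb _ (pt_mem i) hi with ⟨𝔭, rfl⟩ | hzB
  · left
    have h𝔭 : 𝔭 ∈ (vertexChart hb 0) ⁻¹' closure (b ⁻¹' ({y : Proj (grading (Fin (2 + 1 + 1)) k) |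
          (X 1 - C ((![![0, 0], ![1, 0], ![0, 1]] : Fin (2 + 1) → Fin 2 → k) i 0) * X 0 : MvPolynomial (Fin (2 + 1 + 1)) k) ∈
              y.asHomogeneousIdeal ∧
          (X 2 - C ((![![0, 0], ![1, 0], ![0, 1]] : Fin (2 + 1) → Fin 2 → k) i 1) * X 0 : MvPolynomial (Fin (2 + 1 + 1)) k) ∈
              y.asHomogeneousIdeal} \ {vertex 2 k})) := hi
    rw [preimage_vertexChart_line b hb, ← map_lineIdeal ΦA hΦA0 hΦA1 hΦAc] at h𝔭
    exact apply_mem_basicOpen_symm (vertexChart hb 0) θA hθA _ _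
      (fun 𝔮 h𝔮 => map_ell_notMem ΦA hΦAc c hc1 hc2 _ (pt_mem i) 𝔮 h𝔮) 𝔭 h𝔭
  · right
    rw [← hcBim] at hzB
    obtain ⟨𝔭, -, rfl⟩ := hzB
    have h𝔭 : 𝔭 ∈ cB ⁻¹' closure (b ⁻¹' ({y : Proj (grading (Fin (2 + 1 + 1)) k) |
          (X 1 - C ((![![0, 0], ![1, 0], ![0, 1]] : Fin (2 + 1) → Fin 2 → k) i 0) * X 0 : MvPolynomial (Fin (2 + 1 + 1)) k) ∈
              y.asHomogeneousIdeal ∧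
          (X 2 - C ((![![0, 0], ![1, 0], ![0, 1]] : Fin (2 + 1) → Fin 2 → k) i 1) * X 0 : MvPolynomial (Fin (2 + 1 + 1)) k) ∈
              y.asHomogeneousIdeal} \ {vertex 2 k})) := hi
    rw [preimage_lift_line b cB hcB, ← map_lineIdeal ΦB hΦB0 hΦB1 hΦBc] at h𝔭
    exact apply_mem_basicOpen_symm cB θB hθB _ _
      (fun 𝔮 h𝔮 => map_ell_notMem ΦB hΦBc c hc1 hc2 _ (pt_mem i) 𝔮 h𝔮) 𝔭 h𝔭

end Charts

end ThreeLines

end Summit.ResolutionOfSingularities.ResolutionOfSingularities.Cruxes.EquisingularLiftNat.Sections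

end
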